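import Mathlib
import HarnessLib
import Literature.Analysis.FluidPDE.NewtonPotentialHolder
import Summits.NavierStokesRegularity.NavierStokesRegularity.Theorems.ChiralWindowDoorDefs
import Summits.NavierStokesRegularity.NavierStokesRegularity.Theorems.CriticalFluxDoorDefs
import Summits.NavierStokesRegularity.NavierStokesRegularity.Theorems.ChiralWindowDoorClassDerivDecay
import Summits.NavierStokesRegularity.NavierStokesRegularity.Theorems.ChiralWindowDoorLambda

/-!
# Door S21-C «CriticalFluxDoor» — the WEIGHTED `Λ`-DECAY LEMMA (F3-DERIVATION §0): `‖Λf(x)‖ ≤ c(A+B)(‖x‖+a)⁻²`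

Door S21-C of nsreg-p1's local Type-I door family (`HOME/ns-regularity-ideate-p1/ROUND-20.md`, texts `r20/Sketch21v3.lean`;
DESIGN-ONLY, route NOT born).  First file of the bookkeeping behind stub F3 `stub_critEnergyBudget` (the windowed
critical-energy budget, `HOME/ns-regularity-ideate-p1/r20/F3-DERIVATION.md`): the size of `Λv` in the door class.

For a `C²` field `f : ℝ³ → ℝ³` with `‖f(y)‖ ≤ A/(‖y‖+a)` and `‖D²f(y)‖ ≤ B/(‖y‖+a)³` (`a > 0`):
`‖Λf(x)‖ ≤ (24|B₁|/π²)·(A + B)·(‖x‖+a)⁻²`, where `Λ = fracLapHalf` is the tree's second-difference kernel form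
(`…ChiralWindowDoorDefs`).  Proof: split the `z`-integral at `L = (‖x‖+a)/2` — near field by the LOCALISED second-difference
bound on `B̄(x,L)` (`norm_secondDiff_le_local`), far field by the kernel tail `∫_{‖z‖≥L}‖z‖⁻⁴ = 3|B₁|/L` and the translated
`∫_{B_L}‖w‖⁻¹ ≤ 3|B₁|L²/2` for the two cross terms (tree `NewtonPotentialHolder.integral_ball_norm_rpow_neg` /
`integral_compl_ball_norm_rpow_neg`; the cut-off profile `kfun` and the constant `lamDecayConst` are in `…CriticalFluxDoorDefs`).

* E1 `norm_secondDiff_le_local` · E2 `lamK_eq_rpow`, `lamK_mul_sq_le`, `integrable_kfun`, `integral_kfun_le` ·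
  E3 `norm_fracLapHalf_le_weighted` · E4 `fracLapHalf_sliceDecay_of_class`: for a door-class slice `v s` (`a = √(−s)`,
  `A = D`, `B = K` from `derivDecay_of_class`) ONE constant `K'` with `(‖x‖+√(−s))²‖Λv(s,x)‖ ≤ K'` for all `s < 0` — the
  `K'` of F3-DERIVATION §0 (and of S20's flux table).

Proofs: nsreg-p1 g17 (`HOME/ns-regularity-ideate-p1/r20/LambdaDecay.lean` v5 03ddea5d3d6ad0be, §§E1–E4, farm rc 0; re-checked
on tree HEAD 2026-08-27 by nsreg-p6 g13 and landed verbatim up to the spelling of `ℝ³`).  Seat nsreg-p6 g13 (THEOREMS-ONLY door sequels, DIRECTOR-NS g8 #32 (2)/#36).  WHAT THIS IS NOT: not NS regularity (Clay A); pure real analysis about the kernel form of `Λ`; no route is opened.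
-/

noncomputable section

-- the summit and its single sub-problem share the name (CONVENTIONS §1), as in every Theorems file
set_option linter.dupNamespace false

namespace Summit.NavierStokesRegularity.NavierStokesRegularity.Theorems.CriticalFluxDoorLambdaDecay

open MeasureTheory Metric Set Filter Topology Function
open Literature.Analysis Literature.Analysis.FluidPDE
open Summit.NavierStokesRegularity.NavierStokesRegularity.Theorems.ChiralWindowDoorDefs
open Summit.NavierStokesRegularity.NavierStokesRegularity.Theorems.CriticalFluxDoorDefs
open Summit.NavierStokesRegularity.NavierStokesRegularity.Theorems.ChiralWindowDoorClassDerivDecay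
open Summit.NavierStokesRegularity.NavierStokesRegularity.Theorems.ChiralWindowDoorLambda
  (integrable_fracLapHalf_integrand_of_contDiff lamK_mul_sq_le)

/-! ## E1 — localised second-difference bound -/

/-- `‖2f(x) − f(x+z) − f(x−z)‖ ≤ 2M‖z‖²` whenever `‖D²f‖ ≤ M` on the closed ball `B̄(x,r)` and `‖z‖ ≤ r`
(two mean-value inequalities on convex balls). -/
theorem norm_secondDiff_le_local {E F : Type*} [NormedAddCommGroup E] [NormedSpace ℝ E] [NormedAddCommGroup F]
    [NormedSpace ℝ F] {f : E → F} (hf : ContDiff ℝ 2 f) {x : E} {r M : ℝ}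
    (hM : ∀ y ∈ closedBall x r, ‖fderiv ℝ (fderiv ℝ f) y‖ ≤ M) {z : E} (hz : ‖z‖ ≤ r) :
    ‖(2 : ℝ) • f x - f (x + z) - f (x - z)‖ ≤ 2 * M * ‖z‖ ^ 2 := by
  have hd : Differentiable ℝ f := hf.differentiable (by norm_num)
  have hd2 : Differentiable ℝ (fderiv ℝ f) :=
    (hf.fderiv_right (m := 1) (by norm_num)).differentiable (by norm_num)
  have hr : 0 ≤ r := (norm_nonneg z).trans hz
  have hMnn : 0 ≤ M := le_trans (norm_nonneg (fderiv ℝ (fderiv ℝ f) x)) (hM x (mem_closedBall_self hr))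
  have hLip : ∀ a ∈ closedBall x r, ∀ b ∈ closedBall x r,
      ‖fderiv ℝ f b - fderiv ℝ f a‖ ≤ M * ‖b - a‖ := fun a ha b hb =>
    (convex_closedBall x r).norm_image_sub_le_of_norm_fderiv_le (fun y _ => hd2 y) hM ha hb
  set h : E → F := fun w => (2 : ℝ) • f x - f (x + w) - f (x - w) with hh
  have hder : ∀ w, HasFDerivAt h (fderiv ℝ f (x - w) - fderiv ℝ f (x + w)) w := by
    intro w
    have h1 : HasFDerivAt (fun w => f (x + w)) (fderiv ℝ f (x + w)) w := by
      have := (hd (x + w)).hasFDerivAt.comp w ((hasFDerivAt_id w).const_add x)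
      simpa [Function.comp_def] using this
    have h2 : HasFDerivAt (fun w => f (x - w)) (-fderiv ℝ f (x - w)) w := by
      have := (hd (x - w)).hasFDerivAt.comp w ((hasFDerivAt_id w).const_sub x)
      simpa [Function.comp_def] using this
    have h3 : HasFDerivAt h (0 - fderiv ℝ f (x + w) - -fderiv ℝ f (x - w)) w :=
      ((hasFDerivAt_const ((2 : ℝ) • f x) w).sub h1).sub h2
    exact h3.congr_fderiv (by abel)
  have hdiff : ∀ w, DifferentiableAt ℝ h w := fun w => (hder w).differentiableAt
  have hbound : ∀ w ∈ closedBall (0 : E) ‖z‖, ‖fderiv ℝ h w‖ ≤ 2 * M * ‖z‖ := by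
    intro w hw
    rw [(hder w).fderiv]
    have hw' : ‖w‖ ≤ ‖z‖ := by simpa [mem_closedBall, dist_zero_right] using hw
    have hxw1 : x - w ∈ closedBall x r := by
      rw [mem_closedBall, dist_eq_norm, sub_sub_cancel_left, norm_neg]; linarith
    have hxw2 : x + w ∈ closedBall x r := by
      rw [mem_closedBall, dist_eq_norm, add_sub_cancel_left]; linarith
    calc ‖fderiv ℝ f (x - w) - fderiv ℝ f (x + w)‖ ≤ M * ‖(x - w) - (x + w)‖ := hLip _ hxw2 _ hxw1
      _ = M * (2 * ‖w‖) := by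
          rw [show x - w - (x + w) = -((2 : ℝ) • w) by simp [two_smul]; abel, norm_neg, norm_smul,
            Real.norm_eq_abs, abs_of_pos (by norm_num : (0 : ℝ) < 2)]
      _ ≤ M * (2 * ‖z‖) := by gcongr
      _ = 2 * M * ‖z‖ := by ring
  have hmv := Convex.norm_image_sub_le_of_norm_fderiv_le (fun w _ => hdiff w) hbound
    (convex_closedBall (0 : E) ‖z‖) (mem_closedBall_self (norm_nonneg z))
    (by simp [mem_closedBall, dist_zero_right] : z ∈ closedBall (0 : E) ‖z‖)
  have h0 : h 0 = 0 := by simp [hh, two_smul]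
  rw [h0, sub_zero, sub_zero] at hmv
  calc ‖(2 : ℝ) • f x - f (x + z) - f (x - z)‖ = ‖h z‖ := rfl
    _ ≤ 2 * M * ‖z‖ * ‖z‖ := hmv
    _ = 2 * M * ‖z‖ ^ 2 := by ring


/-! ## E2 — kernel algebra -/

/-- `lamK z = π⁻² ‖z‖^{-4}` as a real power, for `z ≠ 0`. -/
theorem lamK_eq_rpow {z : EuclideanSpace ℝ (Fin 3)} (hz : z ≠ 0) : lamK z = (1 / Real.pi ^ 2) * ‖z‖ ^ (-(4 : ℝ)) := by
  have hn : 0 < ‖z‖ := norm_pos_iff.2 hz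
  unfold lamK
  rw [Real.rpow_neg hn.le, show (4 : ℝ) = ((4 : ℕ) : ℝ) by norm_num, Real.rpow_natCast]

/-! ## E3 — the weighted decay bound -/

/-- The cut-off profile `kfun L a` (`(‖w‖+a)⁻¹` on `B_L`, `0` outside) is integrable for `a > 0`. -/
theorem integrable_kfun {L a : ℝ} (ha : 0 < a) : Integrable (kfun L a) := by
  unfold kfun
  rw [integrable_indicator_iff measurableSet_ball]
  refine Measure.integrableOn_of_bounded (M := a⁻¹) measure_ball_lt_top.ne
    ((continuous_norm.add continuous_const).inv₀ fun w =>
      (add_pos_of_nonneg_of_pos (norm_nonneg w) ha).ne').aestronglyMeasurable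
    (Eventually.of_forall fun w => ?_)
  rw [Real.norm_eq_abs, abs_of_pos (by positivity)]
  exact inv_anti₀ ha (by linarith [norm_nonneg w])

/-- `∫ k ≤ 3|B₁| L²/2` (compare with `‖w‖⁻¹` away from the origin, then the radial integral). -/
theorem integral_kfun_le {L a : ℝ} (hL : 0 < L) (ha : 0 < a) :
    ∫ w, kfun L a w ≤ 3 * (volume : Measure (EuclideanSpace ℝ (Fin 3))).real (ball 0 1) * (L ^ 2 / 2) := by
  unfold kfun
  rw [integral_indicator measurableSet_ball]
  have hint : IntegrableOn (fun w : EuclideanSpace ℝ (Fin 3) => ‖w‖ ^ (-(1 : ℝ))) (ball 0 L) volume :=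
    NewtonPotentialHolder.integrableOn_ball_norm_rpow_neg (by norm_num) L
  have h0 : ∀ᵐ w ∂(volume : Measure (EuclideanSpace ℝ (Fin 3))), w ≠ 0 := by rw [ae_iff]; simp
  have hpt : ∀ᵐ w ∂(volume.restrict (ball (0 : EuclideanSpace ℝ (Fin 3)) L)), (‖w‖ + a)⁻¹ ≤ ‖w‖ ^ (-(1 : ℝ)) := by
    refine ae_restrict_of_ae ?_
    filter_upwards [h0] with w hw
    have hwpos : 0 < ‖w‖ := norm_pos_iff.2 hw
    rw [Real.rpow_neg hwpos.le, Real.rpow_one]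
    exact inv_anti₀ hwpos (by linarith)
  calc ∫ w in ball (0 : EuclideanSpace ℝ (Fin 3)) L, (‖w‖ + a)⁻¹ ≤ ∫ w in ball (0 : EuclideanSpace ℝ (Fin 3)) L, ‖w‖ ^ (-(1 : ℝ)) :=
        integral_mono_of_nonneg (Eventually.of_forall fun w => by positivity) hint hpt
    _ = 3 * (volume : Measure (EuclideanSpace ℝ (Fin 3))).real (ball 0 1) * (L ^ ((3 : ℝ) - 1) / (3 - 1)) :=
        NewtonPotentialHolder.integral_ball_norm_rpow_neg (by norm_num) hL
    _ = 3 * (volume : Measure (EuclideanSpace ℝ (Fin 3))).real (ball 0 1) * (L ^ 2 / 2) := by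
        rw [show (3 : ℝ) - 1 = 2 by norm_num, Real.rpow_two]

/-- **Weighted `Λ`-decay.**  `C²` field, `‖f(y)‖ ≤ A/(‖y‖+a)`, `‖D²f(y)‖ ≤ B/(‖y‖+a)³`, `a > 0` ⇒
`‖Λf(x)‖ ≤ (24|B₁|/π²)(A+B)(‖x‖+a)⁻²`. -/
theorem norm_fracLapHalf_le_weighted {f : EuclideanSpace ℝ (Fin 3) → EuclideanSpace ℝ (Fin 3)} (hf : ContDiff ℝ 2 f) {A B a : ℝ} (ha : 0 < a)
    (hA : ∀ y, ‖f y‖ ≤ A / (‖y‖ + a)) (hB : ∀ y, ‖fderiv ℝ (fderiv ℝ f) y‖ ≤ B / (‖y‖ + a) ^ 3) (x : EuclideanSpace ℝ (Fin 3)) :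
    ‖fracLapHalf f x‖ ≤ lamDecayConst * (A + B) / (‖x‖ + a) ^ 2 := by
  -- signs of the constants
  have hA0 : 0 ≤ A := by
    have h := le_trans (norm_nonneg (f 0)) (hA 0)
    rw [norm_zero, zero_add] at h
    by_contra hneg
    push Not at hneg
    have : A / a < 0 := div_neg_of_neg_of_pos hneg ha
    linarith
  have hB0 : 0 ≤ B := by
    have h := le_trans (norm_nonneg (fderiv ℝ (fderiv ℝ f) 0)) (hB 0)
    rw [norm_zero, zero_add] at h
    by_contra hneg
    push Not at hneg
    have : B / a ^ 3 < 0 := div_neg_of_neg_of_pos hneg (by positivity)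
    linarith
  set L : ℝ := (‖x‖ + a) / 2 with hL
  have hL0 : 0 < L := by positivity
  have hxa : ‖x‖ + a = 2 * L := by rw [hL]; ring
  set β : ℝ := 1 / Real.pi ^ 2 with hβ
  have hβ0 : 0 < β := by positivity
  set Bv : ℝ := (volume : Measure (EuclideanSpace ℝ (Fin 3))).real (ball 0 1) with hBv
  have hBv0 : 0 ≤ Bv := measureReal_nonneg
  -- coefficients of the dominating function
  set c₁ : ℝ := β * (2 * (B / L ^ 3)) with hc₁
  set c₂ : ℝ := β * (2 * (A / (‖x‖ + a)) + 2 * (A / L)) with hc₂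
  set c₃ : ℝ := β * A / L ^ 4 with hc₃
  have hc₁0 : 0 ≤ c₁ := by positivity
  have hc₂0 : 0 ≤ c₂ := by positivity
  have hc₃0 : 0 ≤ c₃ := by positivity
  set k : EuclideanSpace ℝ (Fin 3) → ℝ := kfun L a with hk
  have hk_nn : ∀ w, 0 ≤ k w := fun w => kfun_nonneg ha w
  set G : EuclideanSpace ℝ (Fin 3) → ℝ := fun z =>
    (ball (0 : EuclideanSpace ℝ (Fin 3)) L).indicator (fun z => c₁ * ‖z‖ ^ (-(2 : ℝ))) z +
    (ball (0 : EuclideanSpace ℝ (Fin 3)) L)ᶜ.indicator (fun z => c₂ * ‖z‖ ^ (-(4 : ℝ))) z +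
    c₃ * (k (x + z) + k (z - x)) with hG
  -- second-derivative sup on the closed ball `B̄(x, L)`
  have hM : ∀ y ∈ closedBall x L, ‖fderiv ℝ (fderiv ℝ f) y‖ ≤ B / L ^ 3 := by
    intro y hy
    rw [mem_closedBall, dist_eq_norm] at hy
    have h1 : L ≤ ‖y‖ + a := by
      have : ‖x‖ ≤ ‖y‖ + ‖y - x‖ := by
        calc ‖x‖ = ‖y - (y - x)‖ := by rw [sub_sub_cancel]
          _ ≤ ‖y‖ + ‖y - x‖ := norm_sub_le _ _
      linarith
    calc ‖fderiv ℝ (fderiv ℝ f) y‖ ≤ B / (‖y‖ + a) ^ 3 := hB y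
      _ ≤ B / L ^ 3 := by
          apply div_le_div_of_nonneg_left hB0 (by positivity)
          exact pow_le_pow_left₀ hL0.le h1 3
  -- nonnegativity of the three parts of `G`
  have hG1 : ∀ z, 0 ≤ (ball (0 : EuclideanSpace ℝ (Fin 3)) L).indicator (fun z => c₁ * ‖z‖ ^ (-(2 : ℝ))) z := by
    intro z; by_cases hz : z ∈ ball (0 : EuclideanSpace ℝ (Fin 3)) L
    · rw [indicator_of_mem hz]; exact mul_nonneg hc₁0 (Real.rpow_nonneg (norm_nonneg _) _)
    · rw [indicator_of_notMem hz]
  have hG2 : ∀ z, 0 ≤ (ball (0 : EuclideanSpace ℝ (Fin 3)) L)ᶜ.indicator (fun z => c₂ * ‖z‖ ^ (-(4 : ℝ))) z := by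
    intro z; by_cases hz : z ∈ (ball (0 : EuclideanSpace ℝ (Fin 3)) L)ᶜ
    · rw [indicator_of_mem hz]; exact mul_nonneg hc₂0 (Real.rpow_nonneg (norm_nonneg _) _)
    · rw [indicator_of_notMem hz]
  have hG3 : ∀ z, 0 ≤ c₃ * (k (x + z) + k (z - x)) := fun z =>
    mul_nonneg hc₃0 (add_nonneg (hk_nn _) (hk_nn _))
  -- POINTWISE DOMINATION
  have hdom : ∀ z, ‖lamK z • ((2 : ℝ) • f x - f (x + z) - f (x - z))‖ ≤ G z := by
    intro z
    rw [norm_smul, Real.norm_eq_abs, abs_of_nonneg (lamK_nonneg z)]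
    by_cases hz : ‖z‖ < L
    · -- near field
      have hzb : z ∈ ball (0 : EuclideanSpace ℝ (Fin 3)) L := mem_ball_zero_iff.2 hz
      have h1 : ‖(2 : ℝ) • f x - f (x + z) - f (x - z)‖ ≤ 2 * (B / L ^ 3) * ‖z‖ ^ 2 :=
        norm_secondDiff_le_local hf hM hz.le
      have h2 : lamK z * ‖(2 : ℝ) • f x - f (x + z) - f (x - z)‖ ≤ c₁ * ‖z‖ ^ (-(2 : ℝ)) :=
        (mul_le_mul_of_nonneg_left h1 (lamK_nonneg z)).trans (lamK_mul_sq_le (by positivity) z)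
      have h3 : (ball (0 : EuclideanSpace ℝ (Fin 3)) L).indicator (fun z => c₁ * ‖z‖ ^ (-(2 : ℝ))) z = c₁ * ‖z‖ ^ (-(2 : ℝ)) := by
        rw [indicator_of_mem hzb]
      have := hG2 z
      have := hG3 z
      show _ ≤ (ball (0 : EuclideanSpace ℝ (Fin 3)) L).indicator (fun z => c₁ * ‖z‖ ^ (-(2 : ℝ))) z +
        (ball (0 : EuclideanSpace ℝ (Fin 3)) L)ᶜ.indicator (fun z => c₂ * ‖z‖ ^ (-(4 : ℝ))) z + c₃ * (k (x + z) + k (z - x))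
      linarith
    · -- far field
      push Not at hz
      have hzpos : 0 < ‖z‖ := hL0.trans_le hz
      have hz0 : z ≠ 0 := norm_pos_iff.1 hzpos
      have hzc : z ∈ (ball (0 : EuclideanSpace ℝ (Fin 3)) L)ᶜ := by rw [mem_compl_iff, mem_ball_zero_iff]; exact not_lt.2 hz
      have hK : lamK z = β * ‖z‖ ^ (-(4 : ℝ)) := lamK_eq_rpow hz0
      have hr4nn : 0 ≤ ‖z‖ ^ (-(4 : ℝ)) := Real.rpow_nonneg (norm_nonneg _) _
      have hr4 : ‖z‖ ^ (-(4 : ℝ)) ≤ (L ^ 4)⁻¹ := by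
        rw [Real.rpow_neg hzpos.le, show (4 : ℝ) = ((4 : ℕ) : ℝ) by norm_num, Real.rpow_natCast]
        exact inv_anti₀ (by positivity) (pow_le_pow_left₀ hL0.le hz 4)
      have htri : ‖(2 : ℝ) • f x - f (x + z) - f (x - z)‖ ≤ 2 * ‖f x‖ + ‖f (x + z)‖ + ‖f (x - z)‖ := by
        have e1 := norm_sub_le ((2 : ℝ) • f x - f (x + z)) (f (x - z))
        have e2 := norm_sub_le ((2 : ℝ) • f x) (f (x + z))
        have e3 : ‖(2 : ℝ) • f x‖ = 2 * ‖f x‖ := by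
          rw [norm_smul, Real.norm_eq_abs, abs_of_pos (by norm_num : (0 : ℝ) < 2)]
        linarith
      -- cross terms: `β‖z‖⁻⁴‖f y‖ ≤ β‖z‖⁻⁴(A/L) + c₃ k y`
      have hcr : ∀ y : EuclideanSpace ℝ (Fin 3), β * ‖z‖ ^ (-(4 : ℝ)) * ‖f y‖ ≤ β * ‖z‖ ^ (-(4 : ℝ)) * (A / L) + c₃ * k y := by
        intro y
        by_cases hy : ‖y‖ + a ≤ L
        · have hya : 0 < ‖y‖ + a := by positivity
          have hyb : y ∈ ball (0 : EuclideanSpace ℝ (Fin 3)) L := by rw [mem_ball_zero_iff]; linarith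
          have hky : k y = (‖y‖ + a)⁻¹ := by rw [hk]; unfold kfun; rw [indicator_of_mem hyb]
          have h1 : ‖f y‖ ≤ A * (‖y‖ + a)⁻¹ := by rw [← div_eq_mul_inv]; exact hA y
          have h2 : β * ‖z‖ ^ (-(4 : ℝ)) * ‖f y‖ ≤ β * (L ^ 4)⁻¹ * (A * (‖y‖ + a)⁻¹) :=
            mul_le_mul (mul_le_mul_of_nonneg_left hr4 hβ0.le) h1 (norm_nonneg _) (by positivity)
          have h3 : β * (L ^ 4)⁻¹ * (A * (‖y‖ + a)⁻¹) = c₃ * k y := by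
            rw [hky, hc₃]; field_simp
          have h4 : 0 ≤ β * ‖z‖ ^ (-(4 : ℝ)) * (A / L) := by positivity
          linarith
        · push Not at hy
          have hfy : ‖f y‖ ≤ A / L := (hA y).trans (div_le_div_of_nonneg_left hA0 hL0 hy.le)
          have h2 := mul_le_mul_of_nonneg_left hfy (mul_nonneg hβ0.le hr4nn)
          have h4 : 0 ≤ c₃ * k y := mul_nonneg hc₃0 (hk_nn y)
          linarith
      have hcx := hcr (x + z)
      have hcx' := hcr (x - z)
      have hkxz : k (x - z) = k (z - x) := by
        rw [hk, show x - z = -(z - x) by abel, kfun_neg]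
      have hfx : β * ‖z‖ ^ (-(4 : ℝ)) * (2 * ‖f x‖) ≤ β * ‖z‖ ^ (-(4 : ℝ)) * (2 * (A / (‖x‖ + a))) :=
        mul_le_mul_of_nonneg_left (by linarith [hA x]) (mul_nonneg hβ0.le hr4nn)
      have hI2 : (ball (0 : EuclideanSpace ℝ (Fin 3)) L)ᶜ.indicator (fun z => c₂ * ‖z‖ ^ (-(4 : ℝ))) z = c₂ * ‖z‖ ^ (-(4 : ℝ)) := by
        rw [indicator_of_mem hzc]
      have hI1 := hG1 z
      show _ ≤ (ball (0 : EuclideanSpace ℝ (Fin 3)) L).indicator (fun z => c₁ * ‖z‖ ^ (-(2 : ℝ))) z +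
        (ball (0 : EuclideanSpace ℝ (Fin 3)) L)ᶜ.indicator (fun z => c₂ * ‖z‖ ^ (-(4 : ℝ))) z + c₃ * (k (x + z) + k (z - x))
      rw [hI2, hK, ← hkxz]
      have hmain : β * ‖z‖ ^ (-(4 : ℝ)) * ‖(2 : ℝ) • f x - f (x + z) - f (x - z)‖ ≤
          β * ‖z‖ ^ (-(4 : ℝ)) * (2 * ‖f x‖ + ‖f (x + z)‖ + ‖f (x - z)‖) :=
        mul_le_mul_of_nonneg_left htri (mul_nonneg hβ0.le hr4nn)
      have hexp : β * ‖z‖ ^ (-(4 : ℝ)) * (2 * ‖f x‖ + ‖f (x + z)‖ + ‖f (x - z)‖) =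
          β * ‖z‖ ^ (-(4 : ℝ)) * (2 * ‖f x‖) + β * ‖z‖ ^ (-(4 : ℝ)) * ‖f (x + z)‖ +
            β * ‖z‖ ^ (-(4 : ℝ)) * ‖f (x - z)‖ := by ring
      have hc₂e : c₂ * ‖z‖ ^ (-(4 : ℝ)) = β * ‖z‖ ^ (-(4 : ℝ)) * (2 * (A / (‖x‖ + a))) +
          β * ‖z‖ ^ (-(4 : ℝ)) * (A / L) + β * ‖z‖ ^ (-(4 : ℝ)) * (A / L) := by rw [hc₂]; ring
      linarith
  -- INTEGRABILITY of `G`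
  have hI1 : Integrable (fun z => (ball (0 : EuclideanSpace ℝ (Fin 3)) L).indicator (fun z => c₁ * ‖z‖ ^ (-(2 : ℝ))) z) := by
    rw [integrable_indicator_iff measurableSet_ball]
    exact (NewtonPotentialHolder.integrableOn_ball_norm_rpow_neg (by norm_num) L).const_mul c₁
  have hI2 : Integrable (fun z => (ball (0 : EuclideanSpace ℝ (Fin 3)) L)ᶜ.indicator (fun z => c₂ * ‖z‖ ^ (-(4 : ℝ))) z) := by
    rw [integrable_indicator_iff measurableSet_ball.compl]
    exact (NewtonPotentialHolder.integrableOn_compl_ball_norm_rpow_neg (by norm_num) hL0).const_mul c₂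
  have hkint : Integrable k := by rw [hk]; exact integrable_kfun ha
  have hI3a : Integrable (fun z : EuclideanSpace ℝ (Fin 3) => k (x + z)) := hkint.comp_add_left x
  have hI3b : Integrable (fun z : EuclideanSpace ℝ (Fin 3) => k (z - x)) := hkint.comp_sub_right x
  have hI3 : Integrable (fun z : EuclideanSpace ℝ (Fin 3) => c₃ * (k (x + z) + k (z - x))) := (hI3a.add hI3b).const_mul c₃
  have hGint : Integrable G := by rw [hG]; exact (hI1.add hI2).add hI3
  -- THE INTEGRAL OF `G`
  have e1 : ∫ z, (ball (0 : EuclideanSpace ℝ (Fin 3)) L).indicator (fun z => c₁ * ‖z‖ ^ (-(2 : ℝ))) z = c₁ * (3 * Bv * L) := by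
    rw [integral_indicator measurableSet_ball, integral_const_mul,
      NewtonPotentialHolder.integral_ball_norm_rpow_neg (by norm_num) hL0, ← hBv]
    rw [show (3 : ℝ) - 2 = 1 by norm_num, Real.rpow_one]
    ring
  have e2 : ∫ z, (ball (0 : EuclideanSpace ℝ (Fin 3)) L)ᶜ.indicator (fun z => c₂ * ‖z‖ ^ (-(4 : ℝ))) z = c₂ * (3 * Bv * L⁻¹) := by
    rw [integral_indicator measurableSet_ball.compl, integral_const_mul,
      NewtonPotentialHolder.integral_compl_ball_norm_rpow_neg (by norm_num) hL0, ← hBv]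
    rw [show (3 : ℝ) - 4 = -1 by norm_num, Real.rpow_neg_one]
    ring
  have e3 : ∫ z, c₃ * (k (x + z) + k (z - x)) = c₃ * (2 * ∫ w, k w) := by
    rw [integral_const_mul, integral_add hI3a hI3b, integral_add_left_eq_self, integral_sub_right_eq_self]
    ring
  have hkle : ∫ w, k w ≤ 3 * Bv * (L ^ 2 / 2) := by rw [hk, hBv]; exact integral_kfun_le hL0 ha
  have hIG : ∫ z, G z ≤ c₁ * (3 * Bv * L) + c₂ * (3 * Bv * L⁻¹) + c₃ * (2 * (3 * Bv * (L ^ 2 / 2))) := by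
    have hI12 : Integrable (fun z => (ball (0 : EuclideanSpace ℝ (Fin 3)) L).indicator (fun z => c₁ * ‖z‖ ^ (-(2 : ℝ))) z +
        (ball (0 : EuclideanSpace ℝ (Fin 3)) L)ᶜ.indicator (fun z => c₂ * ‖z‖ ^ (-(4 : ℝ))) z) := hI1.add hI2
    have : ∫ z, G z = c₁ * (3 * Bv * L) + c₂ * (3 * Bv * L⁻¹) + c₃ * (2 * ∫ w, k w) := by
      calc ∫ z, G z = ∫ z, ((ball (0 : EuclideanSpace ℝ (Fin 3)) L).indicator (fun z => c₁ * ‖z‖ ^ (-(2 : ℝ))) z +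
            (ball (0 : EuclideanSpace ℝ (Fin 3)) L)ᶜ.indicator (fun z => c₂ * ‖z‖ ^ (-(4 : ℝ))) z) + c₃ * (k (x + z) + k (z - x)) := by
              rw [hG]
        _ = (∫ z, ((ball (0 : EuclideanSpace ℝ (Fin 3)) L).indicator (fun z => c₁ * ‖z‖ ^ (-(2 : ℝ))) z +
            (ball (0 : EuclideanSpace ℝ (Fin 3)) L)ᶜ.indicator (fun z => c₂ * ‖z‖ ^ (-(4 : ℝ))) z)) +
            ∫ z, c₃ * (k (x + z) + k (z - x)) := integral_add hI12 hI3
        _ = ((∫ z, (ball (0 : EuclideanSpace ℝ (Fin 3)) L).indicator (fun z => c₁ * ‖z‖ ^ (-(2 : ℝ))) z) +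
            ∫ z, (ball (0 : EuclideanSpace ℝ (Fin 3)) L)ᶜ.indicator (fun z => c₂ * ‖z‖ ^ (-(4 : ℝ))) z) +
            ∫ z, c₃ * (k (x + z) + k (z - x)) := by rw [integral_add hI1 hI2]
        _ = c₁ * (3 * Bv * L) + c₂ * (3 * Bv * L⁻¹) + c₃ * (2 * ∫ w, k w) := by rw [e1, e2, e3]
    rw [this]
    have : c₃ * (2 * ∫ w, k w) ≤ c₃ * (2 * (3 * Bv * (L ^ 2 / 2))) :=
      mul_le_mul_of_nonneg_left (by linarith) hc₃0
    linarith
  -- `‖Λf(x)‖ ≤ ½ ∫ G`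
  have hhalf : ‖fracLapHalf f x‖ ≤ (1 / 2 : ℝ) * ∫ z, G z := by
    unfold fracLapHalf
    rw [norm_smul, Real.norm_eq_abs, abs_of_pos (by norm_num : (0 : ℝ) < 1 / 2)]
    gcongr
    exact norm_integral_le_of_norm_le hGint (ae_of_all _ hdom)
  -- final algebra: `½ ∫G ≤ 3βBv(B + 2A)/L² ≤ 24βBv(A+B)/(‖x‖+a)²`
  have hval : c₁ * (3 * Bv * L) + c₂ * (3 * Bv * L⁻¹) + c₃ * (2 * (3 * Bv * (L ^ 2 / 2))) =
      3 * Bv * β * (2 * B + 4 * A) / L ^ 2 := by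
    rw [hc₁, hc₂, hc₃, hxa]
    field_simp
    ring
  have hfin : (1 / 2 : ℝ) * (3 * Bv * β * (2 * B + 4 * A) / L ^ 2) ≤ lamDecayConst * (A + B) / (‖x‖ + a) ^ 2 := by
    unfold lamDecayConst
    rw [← hBv, hxa, show (24 : ℝ) * Bv / Real.pi ^ 2 = 24 * Bv * β by rw [hβ]; ring]
    rw [show (1 / 2 : ℝ) * (3 * Bv * β * (2 * B + 4 * A) / L ^ 2) = 3 * Bv * β * (B + 2 * A) / L ^ 2 by ring,
      show (24 : ℝ) * Bv * β * (A + B) / (2 * L) ^ 2 = 3 * Bv * β * (2 * A + 2 * B) / L ^ 2 by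
        field_simp; ring]
    apply div_le_div_of_nonneg_right _ (by positivity)
    have : 0 ≤ 3 * Bv * β := by positivity
    nlinarith
  calc ‖fracLapHalf f x‖ ≤ (1 / 2 : ℝ) * ∫ z, G z := hhalf
    _ ≤ (1 / 2 : ℝ) * (c₁ * (3 * Bv * L) + c₂ * (3 * Bv * L⁻¹) + c₃ * (2 * (3 * Bv * (L ^ 2 / 2)))) := by
        gcongr
    _ = (1 / 2 : ℝ) * (3 * Bv * β * (2 * B + 4 * A) / L ^ 2) := by rw [hval]
    _ ≤ lamDecayConst * (A + B) / (‖x‖ + a) ^ 2 := hfin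

/-! ## E4 — the door-class corollary (F3-DERIVATION §0 verbatim in content):
`(‖x‖+√(−s))² ‖Λv(s,x)‖ ≤ K'` for every door-class profile, one constant for all `s < 0`. -/

/-- **Scale-invariant decay of `Λv` in the door class.**  For a door-class profile (Type-I time rate, Type-I
space–time decay, continuity on the open backward slab, unit-viscosity Oseen–Duhamel identity, divergence-free slices)
there is ONE constant `K'` with `(‖x‖+√(−s))²‖Λ(v s)(x)‖ ≤ K'` for all `s < 0`, `x` — from `norm_fracLapHalf_le_weighted`
with `a = √(−s)`, `A = D`, `B = K` (`derivDecay_of_class`), and the slice smoothness of `exists_classical_of_class`. -/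
theorem fracLapHalf_sliceDecay_of_class {C D : ℝ} {v : ℝ → EuclideanSpace ℝ (Fin 3) → EuclideanSpace ℝ (Fin 3)} (hrate : HasTypeITimeDecay C v)
    (hdec : HasTypeIDecay D v) (hcont : ContinuousOn (uncurry v) (Iio (0 : ℝ) ×ˢ univ))
    (hmild : ∀ s t : ℝ, s < t → t < 0 → ∀ x,
      v t x = UnboundedOperators.heatExtension (v s) (t - s) x - oseenDuhamel 1 s v v t x)
    (hdiv : ∀ t < 0, VectorCalculus.IsDivFree (v t)) :
    ∃ K' : ℝ, ∀ s < (0 : ℝ), ∀ x : EuclideanSpace ℝ (Fin 3), (‖x‖ + Real.sqrt (-s)) ^ 2 * ‖fracLapHalf (v s) x‖ ≤ K' := by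
  obtain ⟨q, hsol⟩ := exists_classical_of_class hrate hcont hmild hdiv
  obtain ⟨K, hK⟩ := derivDecay_of_class C D v hrate hdec hcont hmild hdiv
  refine ⟨lamDecayConst * (D + K), fun s hs x => ?_⟩
  have hcd : ContDiff ℝ 2 (v s) :=
    (hsol.contDiff_velocity (show s ∈ Iio (0 : ℝ) from hs)).of_le (by norm_cast)
  have hsq : 0 < Real.sqrt (-s) := Real.sqrt_pos.2 (neg_pos.2 hs)
  have hB : ∀ y, ‖fderiv ℝ (fderiv ℝ (v s)) y‖ ≤ K / (‖y‖ + Real.sqrt (-s)) ^ 3 := by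
    intro y
    have h2 := (hK s hs y).2.1
    have hconv : ‖fderiv ℝ (fderiv ℝ (v s)) y‖ = ‖iteratedFDeriv ℝ 2 (v s) y‖ := by
      rw [← norm_iteratedFDeriv_one (𝕜 := ℝ) (fderiv ℝ (v s)), norm_iteratedFDeriv_fderiv]
    rw [hconv, le_div_iff₀ (by positivity), mul_comm]
    exact h2
  have h := norm_fracLapHalf_le_weighted hcd hsq (fun y => hdec s hs y) hB x
  rw [le_div_iff₀ (by positivity)] at h
  linarith [h]

end Summit.NavierStokesRegularity.NavierStokesRegularity.Theorems.CriticalFluxDoorLambdaDecay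

end
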